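import Literature.NumberTheory.Automorphic.CDTTheorem712
import Literature.NumberTheory.EllipticCurves.ModFiveCongruenceHesseFamily
import Literature.NumberTheory.EllipticCurves.ModThreeReducibleIffPsi3Root
import Literature.NumberTheory.GaloisRepresentations.AbsGaloisGroup
import Literature.NumberTheory.GaloisRepresentations.ChebotarevOpenSubgroup
import Literature.NumberTheory.EllipticCurves.WeilPairingProofs
import Literature.NumberTheory.EllipticCurves.SzpiroOfAbcProofs
import Mathlib.NumberTheory.LSeries.PrimesInAP
import HarnessLib

/-!
# stub-ideation k3, generation 2 — `stub_switch` (= `CDT_three_five_switch`)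

Helper SIGNATURES (sorried; one prover cycle each unless marked) + the sorry-free assembly
`helpers ⇒ stub_switch`.  Generation 1 (`…StubSwitchK3`, imported) reduced the stub to Fisher's
Hesse family + ONE residual Diophantine atom and listed "R3: one good prime (j = 1728 fibre)".
Generation 2 DECIDES that atom ℓ-adically at ONE prime `ℓ ≡ 5 (mod 12)`:

* `Ψ₃(y² = x³ + āx) = 3x⁴ + 6āx² − ā²` is IRREDUCIBLE over `𝔽_ℓ` for every `ā ≠ 0` when
  `ℓ ≡ 5 (mod 12)` (`(3/ℓ) = (−3/ℓ) = −1`), so a Hesse member `E_t` landing in the `j = 1728` fibre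
  mod `ℓ` has `Ψ₃(E_t)` irreducible over `ℚ` — hence (k2's helperB) `E_t[3]|ℚ(√-3)` abs. irreducible;
  no cube condition, no Serre criterion, no Hilbert irreducibility, no Faltings;
* such `ℓ, t` EXIST by the tree's PROVED Chebotarev (`exists_isArithFrobAt_mul_inv_mem_not_mem`)
  applied to an `L`-rational point `t₁` of the `1728`-fibre, `L = ℚ(E[5], E₀[5])`, `E₀ : y² = x³ + x`
  (Fisher 13.2 (ii) over `L` — the ONE new named fact) and an inertia element at `3`
  (`9 ∤ N_E` ⇒ `√±3 ∉ L`).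
-/

namespace Summit.ABC.ABC.Cruxes.FreyModularity.StubSwitchK3g2

open Literature.NumberTheory.EllipticCurves Literature.NumberTheory.EllipticCurves.HesseFamilyFive
open Literature.NumberTheory.Automorphic Literature.NumberTheory.GaloisRepresentations
open Literature.NumberTheory.Automorphic.BCDT WeierstrassCurve Polynomial

noncomputable section

/-! ## copied verbatim from generation 1 (`…StubSwitchK3`, crux dir `STUB_IDEAS_stub_switch_3_Sketch.lean`)
and k2 (`…StubSwitchIdeas2`), so that this sketch does not import unbuilt crux-dir modules -/

/-- Fisher's Hesse member `E_{l,m} : y² = x³ − 27𝔠₄(l,m)x − 54𝔠₆(l,m)` over `(c₄, c₆)`. -/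
abbrev member (c₄ c₆ l m : ℚ) : WeierstrassCurve ℚ :=
  ⟨0, 0, 0, -27 * C4 c₄ c₆ l m, -54 * C6 c₄ c₆ l m⟩

/-- The `c₄c₆`-model `y² = x³ − 27c₄x − 54c₆` (= the member at `(l:m) = (1:0)`). -/
abbrev base (c₄ c₆ : ℚ) : WeierstrassCurve ℚ := ⟨0, 0, 0, -27 * c₄, -54 * c₆⟩

/-- gen-1 H1 (PROVED there): transport of a framed `5`-torsion model along a `5`-congruence. -/
theorem isTorsionGaloisRep_of_congr {W W' : WeierstrassCurve ℚ} (h : Congr W' W)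
    {ρ : ModPGaloisRep ℚ (ZMod 5) 2} (hρ : W.IsTorsionGaloisRep 5 ρ) :
    W'.IsTorsionGaloisRep 5 ρ := by
  obtain ⟨e', he'⟩ := h
  obtain ⟨e, he⟩ := hρ
  refine ⟨e'.trans e, fun σ P => ?_⟩
  rw [AddEquiv.trans_apply, AddEquiv.trans_apply, he', he]

/-- k2's HB1 = Rubin 1997 Prop. 6 in polynomial form (sorried in k2's sketch, M/L; signature verbatim):
`Ψ₃` irreducible over `ℚ` ⇒ every framed `ρ̄_{E,3}` is abs. irreducible on `Γ_{ℚ(√-3)}`.  Finite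
check behind it (folder `num/gl23.py`): among the 55 subgroups of `GL₂(𝔽₃)`, those with `det` onto,
a `det = −1` involution (complex conjugation) and transitive on `ℙ¹(𝔽₃)` are exactly `N_ns(3)` and
`GL₂(𝔽₃)`, whose intersections with `SL₂(𝔽₃)` (`Q₈`, `SL₂`) are non-abelian. -/
theorem helperB_isAbsIrreducibleOverSqrt_of_irreducible_Ψ₃ (W : WeierstrassCurve ℚ) [W.IsElliptic]
    (hΨ : Irreducible W.Ψ₃) (ρ₃ : ModPGaloisRep ℚ (ZMod 3) 2) (hρ : W.IsTorsionGaloisRep 3 ρ₃) :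
    ρ₃.IsAbsIrreducibleOverSqrt (-3) := by
  sorry

/-- `E₀ : y² = x³ + x` (`j = 1728`, conductor `64`, good at `3`). -/
abbrev E₀ : WeierstrassCurve ℚ := ⟨0, 0, 0, 1, 0⟩

instance : E₀.IsElliptic :=
  ⟨isUnit_iff_ne_zero.mpr (by
    norm_num [E₀, WeierstrassCurve.Δ, WeierstrassCurve.b₂, WeierstrassCurve.b₄, WeierstrassCurve.b₆,
      WeierstrassCurve.b₈])⟩

/-! ## G1 — the `j = 1728` fibre is `3`-irreducible modulo `ℓ ≡ 5 (12)` (S, pure algebra) -/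

/-- G1a (S): `3X⁴ + 6āX² − ā²` is irreducible over `𝔽_ℓ`, `ℓ ≡ 5 (mod 12)`, `ā ≠ 0`.
A root gives `(3x² + 3ā)² = 12ā²` so `3 ∈ 𝔽_ℓ²` — but `(3/ℓ) = −1`; a factor `3(X²+pX+q)(X²−pX+q')`
forces `p = 0 ∧ 16ā²/3 ∈ 𝔽_ℓ²` (again `3 ∈ 𝔽_ℓ²`) or `q = q' ∧ q² = −ā²/3` (`−3 ∈ 𝔽_ℓ²`, but
`ℓ ≡ 2 (3)`).  Checked by brute force for all `ℓ < 140` (folder `num/g1check.py`). -/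
theorem irreducible_Ψ₃_shape_mod (ℓ : ℕ) [Fact ℓ.Prime] (h12 : ℓ % 12 = 5) (a : ZMod ℓ)
    (ha : a ≠ 0) :
    Irreducible (C 3 * X ^ 4 + C (6 * a) * X ^ 2 - C (a ^ 2) : (ZMod ℓ)[X]) := by
  sorry

/-- G1 (M): lift to `ℚ`.  For `ℓ ≡ 5 (12)`, `a` an `ℓ`-unit and `ℓ ∣ b` (or `b = 0`),
`Ψ₃(y² = x³ + ax + b) = 3X⁴ + 6aX² + 12bX − a²` reduces to G1a's quartic, so it is irreducible over
`ℚ` (monic form `Y⁴ + 18aY² + 108bY − 27a²`, `Y = 3X`; Gauss + `Polynomial.Monic.irreducible_of_irreducible_map`). -/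
theorem irreducible_Ψ₃_of_prime_five_mod_twelve (ℓ : ℕ) (hℓ : ℓ.Prime) (h12 : ℓ % 12 = 5)
    (a b : ℚ) (ha : a ≠ 0) (hva : padicValRat ℓ a = 0) (hvb : b = 0 ∨ 0 < padicValRat ℓ b) :
    Irreducible (⟨0, 0, 0, a, b⟩ : WeierstrassCurve ℚ).Ψ₃ := by
  sorry

/-! ## G2 — bookkeeping: a Hesse member in the `1728`-fibre mod `ℓ` (S) -/

/-- G2 (S): `t ≡ t̄₁ (mod ℓ)` with `𝔠₆(t̄₁) = 0 ≠ 𝔠₄(t̄₁)` in `𝔽_ℓ`, `ℓ ∉ {2,3,5,11}` (the primes in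
the denominators `17424 = 2⁴3²11²`, `240` of `C4`, `C6`): the member `E_{t,1}` has `a₄` an `ℓ`-unit,
`ℓ ∣ a₆`, hence `Δ ≡ −64a₄³ ≢ 0`. -/
theorem member_fibre1728_mod (ℓ : ℕ) [Fact ℓ.Prime] (hℓ : ℓ ∉ ({2, 3, 5, 11} : Finset ℕ))
    (c₄ c₆ t : ℤ) (h6 : C6 (c₄ : ZMod ℓ) (c₆ : ZMod ℓ) (t : ZMod ℓ) 1 = 0)
    (h4 : C4 (c₄ : ZMod ℓ) (c₆ : ZMod ℓ) (t : ZMod ℓ) 1 ≠ 0) :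
    (member c₄ c₆ t 1).a₄ ≠ 0 ∧ padicValRat ℓ (member c₄ c₆ t 1).a₄ = 0 ∧
      ((member c₄ c₆ t 1).a₆ = 0 ∨ 0 < padicValRat ℓ (member c₄ c₆ t 1).a₆) ∧
      (member c₄ c₆ t 1).Δ ≠ 0 := by
  sorry

/-! ## G3 — Chebotarev: a fixed algebraic root of `𝔠₆` gives a prime `ℓ ≡ 5 (12)` and a root mod `ℓ` (M) -/

/-- G3 (M): `t₁ ∈ ℚ̄` a root of `𝔠₆(c₄,c₆;·,1)` off the cusps, `σ ∈ Γ_ℚ` fixing `t₁` and acting on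
`μ₁₂` by `5`.  Chebotarev (tree, PROVED: `exists_isArithFrobAt_mul_inv_mem_not_mem` with `N` the
pointwise stabiliser of the `Γ_ℚ`-orbit of `t₁` and of `ζ₁₂`) gives `ℓ ∉ S` and a Frobenius `φ` at
`𝔓 ∣ ℓ` in `σN`: `φ t₁ = t₁ ⇒ t₁ ≡ t̄ ∈ 𝔽_ℓ (mod 𝔓)` (`absIntegersResidue'`), `φ ζ₁₂ = ζ₁₂⁵ ⇒ ℓ ≡ 5 (12)`;
excluding the finitely many `ℓ` below `𝔠₄(t₁)𝔇(t₁)(c₄³ − c₆²)` keeps `𝔠₄(t̄) ≠ 0`. -/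
theorem exists_prime_five_mod_twelve_root (c₄ c₆ : ℤ) (hc : c₄ ^ 3 ≠ c₆ ^ 2)
    (t₁ ζ : AlgebraicClosure ℚ) (h6 : C6 (c₄ : AlgebraicClosure ℚ) c₆ t₁ 1 = 0)
    (hD : D (c₄ : AlgebraicClosure ℚ) c₆ t₁ 1 ≠ 0) (hζ : IsPrimitiveRoot ζ 12)
    (σ : Field.absoluteGaloisGroup ℚ) (hσt : σ • t₁ = t₁) (hσζ : σ • ζ = ζ ^ 5) (S : Finset ℕ) :
    ∃ (ℓ : ℕ) (_ : Fact ℓ.Prime), ℓ ∉ S ∧ ℓ % 12 = 5 ∧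
      ∃ t : ℤ, C6 (c₄ : ZMod ℓ) (c₆ : ZMod ℓ) (t : ZMod ℓ) 1 = 0 ∧
        C4 (c₄ : ZMod ℓ) (c₆ : ZMod ℓ) (t : ZMod ℓ) 1 ≠ 0 := by
  sorry

/-! ## G4 — the `1728`-fibre of `X_E(5)` has a point over `L = ℚ(E[5], E₀[5])` (M/L; ONE named fact) -/

/-- **NAMED FACT to vendor (PUB): Fisher 2012, Thm 13.2 (ii), `n = 5`**, specialised to curves
defined over `ℚ` and a subfield `K ⊆ ℚ̄` (`K` perfect, char `0`): if `E = (y² = x³ − 27c₄x − 54c₆)`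
and `E'` are DIRECTLY `5`-congruent over `K` (a `Gal(ℚ̄/K)`-equivariant `E'[5] ≃ E[5]` respecting
the Weil pairings `e₅`), then `E' ≅_{ℚ̄} E_{λ,μ}` for some `(λ, μ) ∈ K² ∖ 0`.  (Direction (i) is the
tree's `thm132_geomTorsionFive_of_hesseFamily`, whose docstring already flags (ii) as TODO.)
[Fisher2012Hessian, Thm 13.2 (ii) + Def. 13.1, arXiv:math/0610403 p.19; p.4: "perfect field K of
characteristic not dividing 6n".] -/
def Thm132iiMemHesseFamily : Prop :=
  ∀ (E E' : WeierstrassCurve ℚ) [E.IsElliptic] [E'.IsElliptic] (c₄ c₆ : ℚ)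
    (K : IntermediateField ℚ (AlgebraicClosure ℚ)),
    E = ⟨0, 0, 0, -27 * c₄, -54 * c₆⟩ →
    (∃ e : E'.geomTorsion 5 ≃+ E.geomTorsion 5,
      (∀ σ : Field.absoluteGaloisGroup ℚ, (∀ x : AlgebraicClosure ℚ, x ∈ K → σ • x = x) →
        ∀ P : E'.geomTorsion 5, e (σ • P) = σ • e P) ∧
      ∀ P Q : E'.geomTorsion 5,
        weilPairingFun (W := E) (m := 5) (by norm_num) (e P : E.geomPoints) (e Q) =
          weilPairingFun (W := E') (m := 5) (by norm_num) (P : E'.geomPoints) Q) →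
    ∃ (l m : AlgebraicClosure ℚ), l ∈ K ∧ m ∈ K ∧ (l ≠ 0 ∨ m ≠ 0) ∧
      ∃ Cv : VariableChange (AlgebraicClosure ℚ),
        Cv • E'.map (algebraMap ℚ (AlgebraicClosure ℚ)) =
          ⟨0, 0, 0, -27 * C4 (c₄ : AlgebraicClosure ℚ) c₆ l m, -54 * C6 (c₄ : AlgebraicClosure ℚ) c₆ l m⟩

/-- G4 (M/L, uses the named fact): for `c₆ ≠ 0` the polynomial `𝔠₆(c₄,c₆;·,1)` has a root
`t₁ ∈ ℚ̄`, off the cusps, fixed by every `τ ∈ Γ_ℚ` acting trivially on `E[5]` and on `E₀[5]`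
(`t₁ ∈ L := ℚ(E[5], E₀[5])`).  Proof: over `L` both modules are trivial, a symplectic basis match
(`weilPairingFun`, alternating + nondegenerate, tree) is a direct `5`-congruence `E₀ ~ E` over `L`;
the named fact gives `E₀ ≅ E_{λ,μ}`, `λ, μ ∈ L`; `j(E₀) = 1728 ⇒ c₆(E_{λ,μ}) = u⁶c₆(E₀) = 0`
(`variableChange_c₆`), i.e. `𝔠₆(λ,μ) = 0`; `μ ≠ 0` since `𝔠₆(1,0) = c₆ ≠ 0`; `t₁ := λ/μ`. -/
theorem exists_root_C6_fixed (hFii : Thm132iiMemHesseFamily) (c₄ c₆ : ℤ) (hc : c₄ ^ 3 ≠ c₆ ^ 2)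
    (h6 : c₆ ≠ 0) [(base c₄ c₆).IsElliptic] :
    ∃ t₁ : AlgebraicClosure ℚ, C6 (c₄ : AlgebraicClosure ℚ) c₆ t₁ 1 = 0 ∧
      D (c₄ : AlgebraicClosure ℚ) c₆ t₁ 1 ≠ 0 ∧
      ∀ τ : Field.absoluteGaloisGroup ℚ, (∀ P : (base (c₄ : ℚ) c₆).geomTorsion 5, τ • P = P) →
        (∀ P : E₀.geomTorsion 5, τ • P = P) → τ • t₁ = t₁ := by
  sorry

/-- G5 (M): an inertia element at `3`.  `9 ∤ N_E` (good or multiplicative at `3`) ⇒ some `τ ∈ Γ_ℚ`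
acts trivially on `E[5]` and on `E₀[5]` and as `5` on `μ₁₂`: take `τ := τ₀⁵` with `τ₀` in an inertia
group above `3` and `χ̄₃(τ₀) = −1` (tree `exists_fundamentalCharacter_apply_eq`-type input); `τ₀`
fixes `i` (unramified), `ρ̄_{E,5}(τ₀)` is unipotent (`hasLevelOneInertiaShape…` / Néron–Ogg–Shafarevich,
tree) so `ρ̄_{E,5}(τ₀)⁵ = 1`, and `E₀` is good at `3`. -/
theorem exists_inertial_galois_elt (W : WeierstrassCurve ℚ) [W.IsElliptic]
    (h9 : ¬ (9 : ℤ) ∣ W.conductorNorm ℤ) :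
    ∃ (τ : Field.absoluteGaloisGroup ℚ) (ζ : AlgebraicClosure ℚ), IsPrimitiveRoot ζ 12 ∧
      τ • ζ = ζ ^ 5 ∧ (∀ P : W.geomTorsion 5, τ • P = P) ∧ ∀ P : E₀.geomTorsion 5, τ • P = P := by
  sorry

/-! ## G6 — XS glue -/

/-- G6a (XS): an integral rescaling of `(c₄, c₆)`. -/
theorem exists_integral_scaling (x y : ℚ) :
    ∃ (u : ℤ) (c₄ c₆ : ℤ), u ≠ 0 ∧ (c₄ : ℚ) = (u : ℚ) ^ 4 * x ∧ (c₆ : ℚ) = (u : ℚ) ^ 6 * y := by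
  sorry

/-- G6b (XS): the rescaled `c₄c₆`-model is isomorphic (hence `5`-congruent, same conductor) to `W`
(`scale_smul_short`, `congr_fisherModel`, `conductorNorm_smul_rat`). -/
theorem base_scaled (W : WeierstrassCurve ℚ) [W.IsElliptic] {u c₄ c₆ : ℤ} (hu : u ≠ 0)
    (h4 : (c₄ : ℚ) = (u : ℚ) ^ 4 * W.c₄) (h6 : (c₆ : ℚ) = (u : ℚ) ^ 6 * W.c₆) :
    ∃ Cv : VariableChange ℚ, Cv • W = base c₄ c₆ := by
  sorry

/-- G6d (XS): an integer of absolute value `< ℓ` is an `ℓ`-unit. -/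
theorem padicValRat_eq_zero_of_natAbs_lt (ℓ : ℕ) (hℓ : ℓ.Prime) (z : ℤ) (hz : z ≠ 0)
    (hlt : z.natAbs < ℓ) : padicValRat ℓ (z : ℚ) = 0 := by
  sorry

/-- G6c (XS, Dirichlet in Mathlib: `Nat.forall_exists_prime_gt_and_eq_mod`). -/
theorem exists_prime_five_mod_twelve_gt (n : ℕ) : ∃ ℓ : ℕ, ℓ.Prime ∧ n < ℓ ∧ ℓ % 12 = 5 := by
  have h5 : IsUnit ((5 : ℕ) : ZMod 12) := by decide
  obtain ⟨ℓ, hgt, hp, hmod⟩ := Nat.forall_exists_prime_gt_and_eq_mod h5 n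
  refine ⟨ℓ, hp, hgt, ?_⟩
  have := (ZMod.natCast_eq_natCast_iff' ℓ 5 12).1 hmod
  simpa using this

/-! ## Assembly (sorry-free modulo G1–G6, k2's helperB and the two Fisher facts) -/

/-- every `E/ℚ` semistable at `3` is `5`-congruent to an `E'/ℚ` with `Ψ₃(E')` irreducible. -/
def IrreduciblePsi3Source : Prop :=
  ∀ (W : WeierstrassCurve ℚ) [W.IsElliptic], ¬ (9 : ℤ) ∣ W.conductorNorm ℤ →
    ∃ (W' : WeierstrassCurve ℚ) (_ : W'.IsElliptic), Congr W' W ∧ Irreducible W'.Ψ₃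

theorem irreduciblePsi3Source_of_helpers (hF : thm132_geomTorsionFive_of_hesseFamily)
    (hFii : Thm132iiMemHesseFamily) : IrreduciblePsi3Source := by
  intro W _ h9
  -- integral `c₄c₆`-model
  obtain ⟨u, c₄, c₆, hu, h4, h6⟩ := exists_integral_scaling W.c₄ W.c₆
  obtain ⟨Cv, hCv⟩ := base_scaled W hu h4 h6
  haveI hBell : (base (c₄ : ℚ) c₆).IsElliptic := by rw [← hCv]; infer_instance
  have hcongrB : Congr (base (c₄ : ℚ) c₆) W := congr_symm (congr_of_smul_eq Cv hCv)
  have h9B : ¬ (9 : ℤ) ∣ (base (c₄ : ℚ) c₆).conductorNorm ℤ := by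
    rwa [← hCv, conductorNorm_smul_rat]
  have hcQ : (c₄ : ℚ) ^ 3 ≠ (c₆ : ℚ) ^ 2 := by
    intro h
    have h1728 : (1728 : ℚ) * (base (c₄ : ℚ) c₆).Δ = (base (c₄ : ℚ) c₆).c₄ ^ 3 - (base (c₄ : ℚ) c₆).c₆ ^ 2 :=
      (base (c₄ : ℚ) c₆).c_relation
    have hc4 : (base (c₄ : ℚ) c₆).c₄ = 6 ^ 4 * c₄ := by
      simp only [WeierstrassCurve.c₄, WeierstrassCurve.b₂, WeierstrassCurve.b₄]; ring
    have hc6 : (base (c₄ : ℚ) c₆).c₆ = 6 ^ 6 * c₆ := by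
      simp only [WeierstrassCurve.c₆, WeierstrassCurve.b₂, WeierstrassCurve.b₄, WeierstrassCurve.b₆]; ring
    rw [hc4, hc6, mul_pow, mul_pow, h, show ((6 : ℚ) ^ 4) ^ 3 = (6 ^ 6) ^ 2 by norm_num, ← sub_mul,
      sub_self, zero_mul] at h1728
    exact (base (c₄ : ℚ) c₆).isUnit_Δ.ne_zero (by simpa using h1728)
  have hc : c₄ ^ 3 ≠ c₆ ^ 2 := fun h => hcQ (by exact_mod_cast h)
  by_cases hc₆ : c₆ = 0
  · -- `j = 1728`: `W' := base c₄ 0` itself; any prime `ℓ ≡ 5 (12)` above `|27 c₄|` works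
    subst hc₆
    have hc₄ : c₄ ≠ 0 := by rintro rfl; exact hc (by norm_num)
    have hz : (-27 * c₄ : ℤ) ≠ 0 := by omega
    obtain ⟨ℓ, hℓ, hgt, h12⟩ := exists_prime_five_mod_twelve_gt (-27 * c₄).natAbs
    have ha : (-27 * (c₄ : ℚ)) ≠ 0 := by exact_mod_cast hz
    have hva : padicValRat ℓ (-27 * (c₄ : ℚ)) = 0 := by
      have := padicValRat_eq_zero_of_natAbs_lt ℓ hℓ (-27 * c₄) hz hgt
      exact_mod_cast this
    refine ⟨base (c₄ : ℚ) ((0 : ℤ) : ℚ), hBell, hcongrB, ?_⟩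
    exact irreducible_Ψ₃_of_prime_five_mod_twelve ℓ hℓ h12 (-27 * (c₄ : ℚ)) (-54 * ((0 : ℤ) : ℚ))
      ha hva (Or.inl (by simp))
  · -- generic case: the `1728`-fibre road
    obtain ⟨t₁, ht6, htD, hfix⟩ := exists_root_C6_fixed hFii c₄ c₆ hc hc₆
    obtain ⟨τ, ζ, hζ, hτζ, hτE, hτE₀⟩ := exists_inertial_galois_elt (base (c₄ : ℚ) c₆) h9B
    obtain ⟨ℓ, hℓF, hℓS, h12, t, ht6', ht4'⟩ :=
      exists_prime_five_mod_twelve_root c₄ c₆ hc t₁ ζ ht6 htD hζ τ (hfix τ hτE hτE₀) hτζ {2, 3, 5, 11}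
    obtain ⟨ha, hva, hvb, hΔ⟩ := member_fibre1728_mod ℓ hℓS c₄ c₆ t ht6' ht4'
    set E' : WeierstrassCurve ℚ := member c₄ c₆ t 1 with hE'
    haveI hE'ell : E'.IsElliptic := ⟨isUnit_iff_ne_zero.mpr hΔ⟩
    have hirr : Irreducible E'.Ψ₃ :=
      irreducible_Ψ₃_of_prime_five_mod_twelve ℓ hℓF.out h12 E'.a₄ E'.a₆ ha hva hvb
    obtain ⟨e, he⟩ := hF (base (c₄ : ℚ) c₆) E' (c₄ : ℚ) (c₆ : ℚ) (t : ℚ) 1 rfl rfl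
    exact ⟨E', hE'ell, congr_trans ⟨e, he⟩ hcongrB, hirr⟩

/-- the stub with `¬ 9 ∣ N` (semistable at `3` — the only case `FreyModularity_of` ever calls). -/
def SwitchBelowNine : Prop :=
  ∀ (W : WeierstrassCurve ℚ) [W.IsElliptic], ¬ (9 : ℤ) ∣ W.conductorNorm ℤ →
    ∀ (ρ : ModPGaloisRep ℚ (ZMod 5) 2), W.IsTorsionGaloisRep 5 ρ →
      ∃ (W' : WeierstrassCurve ℚ) (_ : W'.IsElliptic), W'.IsTorsionGaloisRep 5 ρ ∧
        ∃ ρ₃' : ModPGaloisRep ℚ (ZMod 3) 2, W'.IsTorsionGaloisRep 3 ρ₃' ∧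
          ρ₃'.IsAbsIrreducibleOverSqrt (-3)

/-- glue: irreducible-`Ψ₃` source + k2's helperB (Rubin 1997 Prop. 6) ⇒ the switch below `9`. -/
theorem switchBelowNine_of (h : IrreduciblePsi3Source) : SwitchBelowNine := by
  intro W _ h9 ρ hρ
  obtain ⟨W', hW', hc, hirr⟩ := h W h9
  haveI := hW'
  obtain ⟨ρ₃, hρ₃⟩ := W'.exists_isTorsionGaloisRep 3
  exact ⟨W', hW', isTorsionGaloisRep_of_congr hc hρ, ρ₃, hρ₃,
    helperB_isAbsIrreducibleOverSqrt_of_irreducible_Ψ₃ W' hirr ρ₃ hρ₃⟩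

/-- the residual slice of the stub AS TYPED: additive, tamely ramified at `3` (`9 ‖ N` or `27 ∤ N ∧ 9 ∣ N`).
Never called by `FreyModularity_of` (Frey curves are semistable); see the memo: either the lead
re-cuts `stub_switch` to `¬ 9 ∣ N` (zero cost) or this slice is closed by the same road through a
different fibre (`√-3 ∈ ℚ(E[5])` can obstruct the `1728`-fibre here). -/
def AdditiveTameResidual : Prop :=
  ∀ (W : WeierstrassCurve ℚ) [W.IsElliptic], (9 : ℤ) ∣ W.conductorNorm ℤ → ¬ 27 ∣ W.conductorNorm ℤ →
    (∀ ρ₃ : ModPGaloisRep ℚ (ZMod 3) 2, W.IsTorsionGaloisRep 3 ρ₃ → ¬ ρ₃.IsAbsIrreducibleOverSqrt (-3)) →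
    ∀ (ρ : ModPGaloisRep ℚ (ZMod 5) 2), W.IsTorsionGaloisRep 5 ρ → ρ.IsAbsIrreducibleOverSqrt 5 →
      ∃ (W' : WeierstrassCurve ℚ) (_ : W'.IsElliptic), W'.IsTorsionGaloisRep 5 ρ ∧
        ∃ ρ₃' : ModPGaloisRep ℚ (ZMod 3) 2, W'.IsTorsionGaloisRep 3 ρ₃' ∧
          ρ₃'.IsAbsIrreducibleOverSqrt (-3)

/-- **The line.**  Fisher 13.2 (i) (tree fact) + Fisher 13.2 (ii) (to vendor) + G1–G6 + helperB
⇒ `stub_switch` on its live domain; the typed residual slice is carried explicitly. -/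
theorem stub_switch_of_helpers (hF : thm132_geomTorsionFive_of_hesseFamily)
    (hFii : Thm132iiMemHesseFamily) (hres : AdditiveTameResidual) : CDT_three_five_switch := by
  intro W _ h27 hii ρ hρ hirr
  by_cases h9 : (9 : ℤ) ∣ W.conductorNorm ℤ
  · exact hres W h9 h27 hii ρ hρ hirr
  · exact switchBelowNine_of (irreduciblePsi3Source_of_helpers hF hFii) W h9 ρ hρ

/-- sanity: the stub is literally the route's named fact. -/
example : CDT_three_five_switch ↔
    (∀ (W : WeierstrassCurve ℚ) [W.IsElliptic], ¬ 27 ∣ W.conductorNorm ℤ →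
      (∀ ρ₃ : ModPGaloisRep ℚ (ZMod 3) 2, W.IsTorsionGaloisRep 3 ρ₃ → ¬ ρ₃.IsAbsIrreducibleOverSqrt (-3)) →
      ∀ (ρ : ModPGaloisRep ℚ (ZMod 5) 2), W.IsTorsionGaloisRep 5 ρ → ρ.IsAbsIrreducibleOverSqrt 5 →
        ∃ (W' : WeierstrassCurve ℚ) (_ : W'.IsElliptic), W'.IsTorsionGaloisRep 5 ρ ∧
          ∃ ρ₃' : ModPGaloisRep ℚ (ZMod 3) 2, W'.IsTorsionGaloisRep 3 ρ₃' ∧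
            ρ₃'.IsAbsIrreducibleOverSqrt (-3)) := Iff.rfl

end

end Summit.ABC.ABC.Cruxes.FreyModularity.StubSwitchK3g2
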